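import Literature.AnabelianGeometry.SemiGraphs.ProSigmaCompletionExtend
import Mathlib.GroupTheory.SemidirectProduct
import Mathlib.Data.Finsupp.Fintype
import Mathlib.Data.ZMod.Basic
import Mathlib.Algebra.BigOperators.Group.Finset.Basic
import Mathlib.Algebra.Group.TypeTags.Finite
import HarnessLib

/-!
# Malnormality of procyclic subgroups of pro-`Σ` completions: the permutation-module engine

[SemiAnbd] Example 2.10 (p. 31) / [AbsAnab] Lemma 1.3.7: in the pro-`Σ` completion `ι : Γ_{g,r} → P` of
a hyperbolic punctured surface group the closed cusp inertia subgroups `I_i = closure ι⟨c_i⟩` are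
MALNORMAL, `I_i ∩ x I_i x⁻¹ = 1` for `x ∉ I_i` — part of abc-iut-L3-t11's named fact
`ProSigmaCuspInertiaMalnormal` (`SurfaceTypeEstranged.lean`) [cite: MochizukiSemiAnbd2006, Ex. 2.10 p.31].
This file is the ENGINE of an elementary proof by finite quotients (no profinite Bass–Serre theory):

* **finite level** (`pow_eq_one_of_wreath_conj`): let `Q` be a group acting on a set `α`, `pt ∈ α` a point
  fixed by `c ∈ Q`, `R` an additive group, and `W = Multiplicative (α →₀ R) ⋊ Q` the semidirect product for
  the translation action `(q·m)(a) = m(q⁻¹ a)`.  If `m₀ : α →₀ R` takes a value `u` at `pt` with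
  `k • u = 0 ⇒ c ^ k = 1`, and VANISHES on the points `c^i x⁻¹ pt`, then an identity
  `(m₀, c)^k = a · (m₀, c)^{k'} · a⁻¹` in `W` with `a` over `x` forces `c ^ k = 1`
  (evaluate the translation components at `pt`: the left side gives `k • u`, the right side `0`);
* **profinite level** (`IsProSigmaCompletion.mem_of_wreathLift`): for a pro-`Σ` completion `ι : Γ → P`
  (`P` profinite), `c ∈ Γ`, `I = closure ι⟨c⟩`, an open normal `N ⊴ P`, a finite `P/N`-set `α` with such a
  point and a LIFT `φ₀ : Γ → W` of `Γ → P/N` (coefficients `ZMod [P:N]`) with `φ₀(c) = (m₀, c̄)`, `m₀` as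
  above relative to `x̄`: every `y ∈ I ∩ x I x⁻¹` lies in `N`;
* two pieces of profinite plumbing: `x ∉ I ⇒ x ∉ I·N` for some open normal `N`, and `y = 1` if `y` lies in
  every open normal subgroup.

The consumer supplies the lift: for a cusp `c_i` of `Γ_{g,r}`, `r ≥ 2`, `m₀ = δ_{pt}` on `α = Q/⟨c̄⟩`
(solving the relator with another cusp); for `r = 1` a two-point `m₀` (`ProSigmaBoundaryMalnormal.lean`).
Theorems only; plain (pro)finite group theory; nothing here bears on [IUTchIII] Cor. 3.12.
-/

namespace Literature.AnabelianGeometry.SemiGraphs.SemiGraphOfAnabelioids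

open Literature.AnabelianGeometry.Anabelioids Multiplicative
open scoped Pointwise

/-! ### Finite level: the translation component of powers and conjugates -/

section Wreath

variable {Q : Type*} [Group Q] {α : Type*} [MulAction Q α] {R : Type*} [AddCommGroup R]
  (τ : Q →* MulAut (Multiplicative (α →₀ R)))

omit [MulAction Q α] in
/-- Powers in `(α →₀ R) ⋊ Q`: the `Q`-component of `(m, g)^k` is `g^k`. [cite: MochizukiSemiAnbd2006, Ex. 2.10 p.31] -/
theorem wreath_pow_right (m : α →₀ R) (g : Q) (k : ℕ) :
    ((⟨ofAdd m, g⟩ : Multiplicative (α →₀ R) ⋊[τ] Q) ^ k).right = g ^ k := by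
  rw [← SemidirectProduct.rightHom_eq_right, map_pow]
  rfl

/-- Powers in `(α →₀ R) ⋊ Q` for the translation action `(q·m)(a) = m(q⁻¹ a)`: the translation
component of `(m, g)^k`, evaluated at `a`, is `∑_{i<k} m (g^{-i} a)`. [cite: MochizukiSemiAnbd2006, Ex. 2.10 p.31] -/
theorem wreath_pow_left_apply (hτ : ∀ (q : Q) (m : Multiplicative (α →₀ R)) (a : α),
      toAdd (τ q m) a = toAdd m (q⁻¹ • a))
    (m : α →₀ R) (g : Q) (k : ℕ) (a : α) :
    toAdd ((⟨ofAdd m, g⟩ : Multiplicative (α →₀ R) ⋊[τ] Q) ^ k).left a =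
      ∑ i ∈ Finset.range k, m ((g ^ i)⁻¹ • a) := by
  induction k with
  | zero => simp
  | succ k ih =>
    rw [pow_succ, SemidirectProduct.mul_left, toAdd_mul, Finsupp.add_apply, ih, wreath_pow_right, hτ,
      Finset.sum_range_succ]
    rfl

/-- Conjugation in `(α →₀ R) ⋊ Q` for the translation action: the translation component of
`a b a⁻¹` at a point `p` is `a_M(p) + b_M(a_Q⁻¹ p) − a_M((a_Q b_Q a_Q⁻¹)⁻¹ p)`. [cite: MochizukiSemiAnbd2006, Ex. 2.10 p.31] -/
theorem wreath_conj_left_apply (hτ : ∀ (q : Q) (m : Multiplicative (α →₀ R)) (a : α),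
      toAdd (τ q m) a = toAdd m (q⁻¹ • a))
    (a b : Multiplicative (α →₀ R) ⋊[τ] Q) (p : α) :
    toAdd (a * b * a⁻¹).left p =
      toAdd a.left p + toAdd b.left (a.right⁻¹ • p) -
        toAdd a.left ((a.right * b.right * a.right⁻¹)⁻¹ • p) := by
  have h1 : (a * b * a⁻¹).left =
      a.left * (τ a.right) b.left * (τ (a.right * b.right * a.right⁻¹)) a.left⁻¹ := by
    simp only [SemidirectProduct.mul_left, SemidirectProduct.mul_right,
      SemidirectProduct.inv_left, map_mul, MulAut.mul_apply]
  rw [h1, toAdd_mul, toAdd_mul, Finsupp.add_apply, Finsupp.add_apply, hτ, map_inv, toAdd_inv,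
    Finsupp.neg_apply, hτ, sub_eq_add_neg]

/-- **The finite-level engine.**  Let `c ∈ Q` fix `pt ∈ α`, let `u ∈ R` satisfy `k • u = 0 ⇒ c^k = 1`,
and let `m₀ : α →₀ R` have `m₀(pt) = u` and vanish at the points `(c^i x⁻¹) pt`, `i ∈ ℤ`.  If
`(m₀, c)^k = a (m₀, c)^{k'} a⁻¹` in `(α →₀ R) ⋊ Q` with `a` lying over `x`, then `c^k = 1`: evaluating
translation components at `pt`, the left side is `k • u`, the right side vanishes (the conjugating
term cancels because `a_Q c^{k'} a_Q⁻¹ = c^k` fixes `pt`). [cite: MochizukiSemiAnbd2006, Ex. 2.10 p.31] -/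
theorem pow_eq_one_of_wreath_conj (hτ : ∀ (q : Q) (m : Multiplicative (α →₀ R)) (a : α),
      toAdd (τ q m) a = toAdd m (q⁻¹ • a))
    {c x : Q} {pt : α} (hc : c • pt = pt) {u : R} (hu : ∀ k : ℕ, k • u = 0 → c ^ k = 1)
    {m₀ : α →₀ R} (h1 : m₀ pt = u) (h0 : ∀ i : ℤ, m₀ ((c ^ i * x⁻¹) • pt) = 0)
    {a : Multiplicative (α →₀ R) ⋊[τ] Q} (ha : a.right = x) {k k' : ℕ}
    (h : (⟨ofAdd m₀, c⟩ : Multiplicative (α →₀ R) ⋊[τ] Q) ^ k =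
      a * (⟨ofAdd m₀, c⟩ : Multiplicative (α →₀ R) ⋊[τ] Q) ^ k' * a⁻¹) :
    c ^ k = 1 := by
  -- powers of `c` fix `pt`
  have hcz : ∀ i : ℤ, c ^ i • pt = pt := fun i => by
    have h' : ∀ n : ℕ, c ^ n • pt = pt := fun n => by
      induction n with
      | zero => simp
      | succ n ih => rw [pow_succ, mul_smul, hc, ih]
    rcases Int.eq_nat_or_neg i with ⟨n, rfl | rfl⟩
    · rw [zpow_natCast, h' n]
    · rw [zpow_neg, zpow_natCast, inv_smul_eq_iff, h' n]
  -- the `Q`-components: `c^k = x c^{k'} x⁻¹`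
  have hright : c ^ k = x * c ^ k' * x⁻¹ := by
    have := congrArg SemidirectProduct.right h
    rwa [wreath_pow_right, SemidirectProduct.mul_right, SemidirectProduct.mul_right,
      SemidirectProduct.inv_right, wreath_pow_right, ha] at this
  -- evaluate translation components at `pt`
  have hleft : toAdd ((⟨ofAdd m₀, c⟩ : Multiplicative (α →₀ R) ⋊[τ] Q) ^ k).left pt =
      toAdd (a * (⟨ofAdd m₀, c⟩ : Multiplicative (α →₀ R) ⋊[τ] Q) ^ k' * a⁻¹).left pt := by rw [h]
  rw [wreath_conj_left_apply τ hτ, wreath_pow_left_apply τ hτ, wreath_pow_left_apply τ hτ, ha,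
    wreath_pow_right, ← hright] at hleft
  -- left side: `k • u`
  have hL : ∑ i ∈ Finset.range k, m₀ ((c ^ i)⁻¹ • pt) = k • u := by
    rw [Finset.sum_congr rfl fun i _ => by rw [← zpow_natCast, ← zpow_neg, hcz, h1],
      Finset.sum_const, Finset.card_range]
  -- middle term: zero
  have hM : ∑ i ∈ Finset.range k', m₀ ((c ^ i)⁻¹ • x⁻¹ • pt) = 0 :=
    Finset.sum_eq_zero fun i _ => by rw [← mul_smul, ← zpow_natCast, ← zpow_neg, h0]
  rw [hL, hM, add_zero, ← zpow_natCast, ← zpow_neg, hcz, sub_self] at hleft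
  exact hu k hleft

end Wreath

/-! ### Profinite plumbing -/

section Profinite

variable {P : Type*} [Group P] [TopologicalSpace P] [IsTopologicalGroup P] [CompactSpace P]
  [TotallyDisconnectedSpace P]

/-- In a profinite group an element lying in every open normal subgroup is trivial. [cite: MochizukiSemiAnbd2006, Ex. 2.10 p.31] -/
theorem eq_one_of_forall_mem_openNormalSubgroup [T2Space P] {y : P}
    (h : ∀ N : OpenNormalSubgroup P, y ∈ (N : Subgroup P)) : y = 1 := by
  by_contra hy
  obtain ⟨N, hN⟩ := ProfiniteGrp.exist_openNormalSubgroup_sub_open_nhds_of_one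
    (isOpen_compl_singleton (x := y)) (show (1 : P) ∈ ({y}ᶜ : Set P) from fun h1 => hy h1.symm)
  exact hN (h N) rfl

/-- If `x` lies outside a closed subgroup `I` of a profinite group, then `x ∉ I · N` for some open normal
subgroup `N` (and hence for every smaller one): the image of `x` in `P/N` lies outside the image of `I`.
[cite: MochizukiSemiAnbd2006, Ex. 2.10 p.31] -/
theorem exists_openNormalSubgroup_not_mem_mul {I : Subgroup P} (hI : IsClosed (I : Set P)) {x : P}
    (hx : x ∉ I) :
    ∃ N : OpenNormalSubgroup P, ∀ N' : OpenNormalSubgroup P, N' ≤ N →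
      ∀ z ∈ I, ∀ n ∈ (N' : Subgroup P), z * n ≠ x := by
  -- the open set `x⁻¹ • Iᶜ` contains `1`, hence an open normal subgroup `N`
  have ho : IsOpen ((fun p => x * p) ⁻¹' (I : Set P)ᶜ) :=
    (hI.isOpen_compl).preimage (continuous_const.mul continuous_id)
  have h1 : (1 : P) ∈ (fun p => x * p) ⁻¹' (I : Set P)ᶜ := by
    change x * 1 ∉ (I : Set P)
    rwa [mul_one]
  obtain ⟨N, hN⟩ := ProfiniteGrp.exist_openNormalSubgroup_sub_open_nhds_of_one ho h1
  refine ⟨N, fun N' hN' z hz n hn hzn => ?_⟩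
  -- `x * n⁻¹ = z ∈ I` with `n⁻¹ ∈ N`
  have hn' : n⁻¹ ∈ (N : Set P) := hN' ((N' : Subgroup P).inv_mem hn)
  have := hN hn'
  change x * n⁻¹ ∉ (I : Set P) at this
  apply this
  rw [← hzn, mul_inv_cancel_right]
  exact hz

omit [CompactSpace P] [TotallyDisconnectedSpace P] in
/-- A continuous homomorphism to a discrete group maps the closure of a subgroup into the image of the
subgroup. [cite: MochizukiSemiAnbd2006, Ex. 2.10 p.31] -/
theorem map_topologicalClosure_le_of_discrete {W : Type*} [Group W] [TopologicalSpace W]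
    [DiscreteTopology W] (φ : P →* W) (hφ : Continuous φ) (H : Subgroup P) :
    H.topologicalClosure ≤ (H.map φ).comap φ := by
  refine H.topologicalClosure_minimal (fun z hz => ⟨z, hz, rfl⟩) ?_
  change IsClosed (φ ⁻¹' ((H.map φ : Subgroup W) : Set W))
  exact (isClosed_discrete _).preimage hφ

omit [TotallyDisconnectedSpace P] in
/-- The quotient of a profinite group by an open normal subgroup is finite. [cite: MochizukiSemiAnbd2006, Ex. 2.10 p.31] -/
theorem finite_quotient_openNormalSubgroup (N : OpenNormalSubgroup P) : Finite (P ⧸ (N : Subgroup P)) := by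
  haveI : DiscreteTopology (P ⧸ (N : Subgroup P)) := QuotientGroup.discreteTopology N.isOpen'
  exact finite_of_compact_of_discrete

omit [TopologicalSpace P] [IsTopologicalGroup P] [CompactSpace P] [TotallyDisconnectedSpace P] in
/-- If no element of `S · N` equals `x`, then the image of `x` in `P/N` lies outside the image of the cyclic
subgroup `⟨z₀⟩ ⊆ S`. [cite: MochizukiSemiAnbd2006, Ex. 2.10 p.31] -/
theorem mk_not_mem_zpowers_of_forall_mul_ne (N : Subgroup P) [N.Normal] {S : Subgroup P} {z₀ x : P}
    (hz₀ : z₀ ∈ S) (hx : ∀ z ∈ S, ∀ n ∈ N, z * n ≠ x) :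
    (QuotientGroup.mk x : P ⧸ N) ∉ Subgroup.zpowers (QuotientGroup.mk z₀ : P ⧸ N) := by
  rintro ⟨j, hj⟩
  dsimp only at hj
  rw [← QuotientGroup.mk_zpow, QuotientGroup.eq] at hj
  exact hx (z₀ ^ j) (S.zpow_mem hz₀ j) _ hj (by rw [mul_inv_cancel_left])

end Profinite

/-! ### Profinite level: an element of `I ∩ x I x⁻¹` dies in every quotient admitting a lift -/

namespace IsProSigmaCompletion

variable {Sigma : Set ℕ} {Γ : Type*} [Group Γ] {P : Type*} [Group P] [TopologicalSpace P]
  [IsTopologicalGroup P] [CompactSpace P] [TotallyDisconnectedSpace P] {ι : Γ →* P}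

/-- Cardinality of the wreath-type group `(α →₀ ZMod n) ⋊ Q`: `n ^ |α| · |Q|`; in particular it is a
`Σ`-integer when `n` and `|Q|` are. [cite: MochizukiSemiAnbd2006, Ex. 2.10 p.31] -/
theorem isSigmaInteger_card_finsuppWreath {Q : Type*} [Group Q] [Finite Q] {α : Type*} [Finite α] {n : ℕ}
    [NeZero n] (τ : Q →* MulAut (Multiplicative (α →₀ ZMod n)))
    (hn : IsSigmaInteger Sigma n) (hQ : IsSigmaInteger Sigma (Nat.card Q)) :
    IsSigmaInteger Sigma (Nat.card (Multiplicative (α →₀ ZMod n) ⋊[τ] Q)) := by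
  have e1 : Nat.card (Multiplicative (α →₀ ZMod n)) = Nat.card (α → ZMod n) :=
    Nat.card_congr (Multiplicative.toAdd.trans Finsupp.equivFunOnFinite)
  rw [SemidirectProduct.card, e1, Nat.card_fun, Nat.card_zmod]
  refine IsSigmaInteger.mul ?_ hQ
  induction Nat.card α with
  | zero => rw [pow_zero]; exact IsSigmaInteger.one Sigma
  | succ k ih => rw [pow_succ]; exact ih.mul hn

/-- **The profinite engine.**  Let `ι : Γ → P` be a pro-`Σ` completion (`P` profinite), `c ∈ Γ`,
`I = closure ι⟨c⟩`, `N ⊴ P` open normal with quotient `Q = P/N`, `n = |Q|`, `c̄, x̄` the images of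
`ι c`, `x`.  Suppose `Q` acts on a finite set `α` with a point `pt` fixed by `c̄`, and there is a
homomorphism `φ₀ : Γ → (α →₀ ZMod n) ⋊ Q` (translation action) lifting `Γ → Q` with
`φ₀(c) = (m₀, c̄)`, where `m₀(pt) = 1` and `m₀` vanishes at the points `c̄^i x̄⁻¹ pt`.  Then every
`y ∈ I ∩ x I x⁻¹` lies in `N`.  (Extend `φ₀` continuously to `P` — the target is a finite `Σ`-group —
and apply the finite-level engine to `φ y = φ(ιc)^k = φ(x) φ(ιc)^{k'} φ(x)⁻¹`.)
[cite: MochizukiSemiAnbd2006, Ex. 2.10 p.31] -/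
theorem mem_of_wreathLift [T2Space P] (hι : IsProSigmaCompletion Sigma ι) (c : Γ)
    (N : OpenNormalSubgroup P) {α : Type*} [Finite α] [MulAction (P ⧸ (N : Subgroup P)) α]
    (τ : (P ⧸ (N : Subgroup P)) →*
      MulAut (Multiplicative (α →₀ ZMod (Nat.card (P ⧸ (N : Subgroup P))))))
    (hτ : ∀ (q : P ⧸ (N : Subgroup P))
      (m : Multiplicative (α →₀ ZMod (Nat.card (P ⧸ (N : Subgroup P))))) (a : α),
      toAdd (τ q m) a = toAdd m (q⁻¹ • a))
    {pt : α} (hc : (QuotientGroup.mk (ι c) : P ⧸ (N : Subgroup P)) • pt = pt) {x : P}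
    {m₀ : α →₀ ZMod (Nat.card (P ⧸ (N : Subgroup P)))} (h1 : m₀ pt = 1)
    (h0 : ∀ i : ℤ, m₀ (((QuotientGroup.mk (ι c) : P ⧸ (N : Subgroup P)) ^ i *
      (QuotientGroup.mk x : P ⧸ (N : Subgroup P))⁻¹) • pt) = 0)
    (φ₀ : Γ →* Multiplicative (α →₀ ZMod (Nat.card (P ⧸ (N : Subgroup P)))) ⋊[τ]
      (P ⧸ (N : Subgroup P)))
    (hφ₀ : ∀ γ, (φ₀ γ).right = QuotientGroup.mk (ι γ)) (hφ₀c : (φ₀ c).left = ofAdd m₀)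
    {y : P} (hy : y ∈ ((Subgroup.zpowers c).map ι).topologicalClosure)
    (hy' : y ∈ ConjAct.toConjAct x • ((Subgroup.zpowers c).map ι).topologicalClosure) :
    y ∈ (N : Subgroup P) := by
  classical
  -- notation-free abbreviations
  haveI : (N : Subgroup P).Normal := N.isNormal'
  haveI : Finite (P ⧸ (N : Subgroup P)) := finite_quotient_openNormalSubgroup N
  haveI : NeZero (Nat.card (P ⧸ (N : Subgroup P))) := ⟨Nat.card_pos.ne'⟩
  have hn : IsSigmaInteger Sigma (Nat.card (P ⧸ (N : Subgroup P))) := by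
    rw [← Subgroup.index_eq_card]
    exact hι.index_open _ N.isNormal' N.isOpen'
  -- the target is a finite `Σ`-group; extend `φ₀` continuously
  letI : TopologicalSpace (Multiplicative (α →₀ ZMod (Nat.card (P ⧸ (N : Subgroup P)))) ⋊[τ]
      (P ⧸ (N : Subgroup P))) := ⊥
  haveI : DiscreteTopology (Multiplicative (α →₀ ZMod (Nat.card (P ⧸ (N : Subgroup P)))) ⋊[τ]
      (P ⧸ (N : Subgroup P))) := ⟨rfl⟩
  haveI : Finite (Multiplicative (α →₀ ZMod (Nat.card (P ⧸ (N : Subgroup P))))) :=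
    Finite.of_equiv _ (Multiplicative.toAdd.trans
      (Finsupp.equivFunOnFinite (α := α) (M := ZMod (Nat.card (P ⧸ (N : Subgroup P)))))).symm
  haveI : Finite (Multiplicative (α →₀ ZMod (Nat.card (P ⧸ (N : Subgroup P)))) ⋊[τ]
      (P ⧸ (N : Subgroup P))) := Finite.of_equiv _ SemidirectProduct.equivProd.symm
  have hW := isSigmaInteger_card_finsuppWreath (Sigma := Sigma) τ hn hn
  obtain ⟨φ, hφc, hφ⟩ := hι.exists_continuous_extend_top hW φ₀
  -- `φ` lies over the quotient map
  have hright : ∀ z : P, (φ z).right = QuotientGroup.mk z := by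
    have hd : Dense (Set.range ι) := hι.dense
    have hc1 : Continuous fun z : P => (φ z).right :=
      continuous_of_discreteTopology.comp hφc
    have hc2 : Continuous fun z : P => (QuotientGroup.mk z : P ⧸ (N : Subgroup P)) := by
      haveI : DiscreteTopology (P ⧸ (N : Subgroup P)) := QuotientGroup.discreteTopology N.isOpen'
      exact QuotientGroup.continuous_mk
    have := Continuous.ext_on hd hc1 hc2 (by rintro _ ⟨γ, rfl⟩; simp only [hφ, hφ₀])
    exact fun z => congrFun this z
  -- `φ y` and `φ (x⁻¹ y x)` are powers of `φ (ι c) = (m₀, c̄)`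
  have hwc : φ (ι c) = ⟨ofAdd m₀, QuotientGroup.mk (ι c)⟩ := by
    rw [hφ]; exact SemidirectProduct.ext hφ₀c (hφ₀ c)
  have hfin : IsOfFinOrder (φ (ι c)) := isOfFinOrder_of_finite _
  have hpow : ∀ z ∈ ((Subgroup.zpowers c).map ι).topologicalClosure, ∃ k : ℕ, φ (ι c) ^ k = φ z := by
    intro z hz
    have hz' := map_topologicalClosure_le_of_discrete φ hφc _ hz
    rw [Subgroup.mem_comap, MonoidHom.map_zpowers, MonoidHom.map_zpowers] at hz'
    exact (hfin.mem_powers_iff_mem_zpowers).2 hz'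
  obtain ⟨k, hk⟩ := hpow y hy
  have hy'' : x⁻¹ * y * x ∈ ((Subgroup.zpowers c).map ι).topologicalClosure := by
    rw [Subgroup.mem_pointwise_smul_iff_inv_smul_mem, ConjAct.smul_def] at hy'
    simpa [mul_assoc] using hy'
  obtain ⟨k', hk'⟩ := hpow _ hy''
  -- the identity `(m₀,c̄)^k = φ x · (m₀,c̄)^{k'} · (φ x)⁻¹`
  have hconj : φ (ι c) ^ k = φ x * φ (ι c) ^ k' * (φ x)⁻¹ := by
    rw [hk, hk', ← map_mul, ← map_inv, ← map_mul]
    congr 1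
    group
  rw [hwc] at hconj
  have hu : ∀ j : ℕ, j • (1 : ZMod (Nat.card (P ⧸ (N : Subgroup P)))) = 0 →
      (QuotientGroup.mk (ι c) : P ⧸ (N : Subgroup P)) ^ j = 1 := by
    intro j hj
    rw [nsmul_eq_mul, mul_one, ZMod.natCast_eq_zero_iff] at hj
    exact orderOf_dvd_iff_pow_eq_one.mp ((orderOf_dvd_natCard _).trans hj)
  have hck := pow_eq_one_of_wreath_conj τ hτ hc hu h1 h0 (hright x) hconj
  -- so `ȳ = c̄^k = 1`
  have : (QuotientGroup.mk y : P ⧸ (N : Subgroup P)) = 1 := by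
    rw [← hright y, ← hk, hwc, wreath_pow_right, hck]
  exact (QuotientGroup.eq_one_iff y).mp this

end IsProSigmaCompletion

end Literature.AnabelianGeometry.SemiGraphs.SemiGraphOfAnabelioids
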